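import Summits.SmoothPoincare4.SmoothPoincare4.Theorems.DottedCircleRasmussenDcrGapHelperFriendsCarrierVkPartAPartIPicture
import Summits.SmoothPoincare4.SmoothPoincare4.Theorems.DottedCircleRasmussenDcrGapHelperFriendsCarrierVkPartATubeLoops
import Literature.Topology.FourManifolds.DehnSurgeryHomology

/-!
# Helper `helper_friendsCarrier_Vk_partA_partI` (V_k part A, part I: the tube framing is the Seifert
framing), piece 3: the collar of the picture about the outer core circle
(line `mk_friends`, crux `DcrGap`; item stmt-SmoothPoincare4-16128, route route-SmoothPoincare4-DottedCircleRasmussen)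

For `0 < ε ≤ 1/40` the picture `W₀ = P(M_k ∩ {0 < |w|² < ε} ∩ {|z| > 20(k+1)})` of the punctured tube about
the OUTER core circle of `M_k` is homeomorphic to `𝕊¹ × (D̊² ∖ 0)`: in the latitude coordinate `q = Λ_k(z)`
(`MMSW.latCoord`) the outer core straightening map `Θᴬ(q, w) = ((ĝ(q) + |w|²) u₀(q), w)` (`MMSW.ΘAout`)
restricted to the level `ĝ + |w|² = 1` is `(u₀(q), w)`, a homeomorphism onto `𝕊¹ × {0 < |w|² < ε}` with smooth
inverse `invFunOn Θᴬ`; hence `H₁(W₀; ℤ)` is generated by the classes of the core-parallel loop `A₀`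
(co-latitude direction `e^{2πit}`, `w = √ε/2`) and of the fibre circle `B₀` (`z = z₁`, `w = (√ε/2) e^{2πit}`)
(`surgeryModel.exists_eq_zsmul_add_zsmul`).  `FriendsCarrierVk.collarOut_*`: the straightening data;
`helper_friendsCarrier_Vk_partA_partI_collarOut`: the registered statement.  No definitions, no named facts,
no `sorry`.  References: R. Kirby, *The Topology of 4-Manifolds*, LNM 1374 (1989), Ch. I §2 [Kirby1989];
A. Hatcher, *Algebraic Topology* (2002), §3.B, Thm. 2A.1 [HatcherAT2002].
-/

set_option linter.dupNamespace false
set_option linter.style.longLine false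

noncomputable section

open scoped Manifold ContDiff Topology ComplexConjugate
open Function Set Metric TopologicalSpace Literature.Topology.FourManifolds Literature.Topology.FourManifolds.MMSW Literature.AlgebraicTopology.Homotopy.HopfFibration
  Literature.AlgebraicTopology.SingularHomology

namespace Summit.SmoothPoincare4.SmoothPoincare4.Theorems.DcrGap.MkFriends

namespace FriendsCarrierVk

variable {k : ℕ} {ε : ℝ}

/-! ## The straightening data of the outer core collar -/

/-- The unit vector `u₀(q)` as the complex number of a circle point: if `u₀(q) = toC u` then the radial
projection of `toE2 q` is `u`. [folklore] -/
theorem collarOut_radialProjection_eq {q : ℂ} (hq : q ≠ 0) {u : sphere (0 : EuclideanSpace ℝ (Fin 2)) 1}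
    (h : unitDir 0 q = toC (u : EuclideanSpace ℝ (Fin 2))) : radialProjection (circlePoint 0) (toE2 q) = u := by
  have h0 : toE2 q ≠ 0 := by rw [Ne, toE2_eq_zero_iff]; exact hq
  apply Subtype.ext
  rw [coe_radialProjection_of_ne_zero _ h0, norm_toE2, ← toE2_real_mul, ← toE2_toC (u : EuclideanSpace ℝ (Fin 2)), ← h, unitDir,
    sub_zero]

/-- `toC` of the radial projection of `toE2 q` is `u₀(q)`. [folklore] -/
theorem collarOut_toC_radialProjection {q : ℂ} (hq : q ≠ 0) :
    toC ((radialProjection (circlePoint 0) (toE2 q) : sphere (0 : EuclideanSpace ℝ (Fin 2)) 1) : EuclideanSpace ℝ (Fin 2)) = unitDir 0 q := by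
  have h0 : toE2 q ≠ 0 := by rw [Ne, toE2_eq_zero_iff]; exact hq
  rw [coe_radialProjection_of_ne_zero _ h0, toC_smul, toC_toE2, norm_toE2, unitDir, sub_zero]

/-- **Every point `(e, w)`, `|e| = 1`, `|w|² < 1/40`, is a straightened point of the outer collar**
(latitudes `c_k − 1/100`, where `ĝ > 1`, and `c_k + 1/60`, where `ĝ < 19/20`). [folklore] -/
theorem collarOut_mem_image (k : ℕ) {e w : ℂ} (he : ‖e‖ = 1) (hw : ‖w‖ ^ 2 < 1 / 40) :
    (e, w) ∈ ΘAout k '' CAout k := by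
  have hc1 := lt_latC (k := k)
  have hc2 := latC_lt (k := k)
  have hw5 : ‖w‖ < 1 / 5 := by nlinarith [norm_nonneg w]
  have he' : ‖toE2 e‖ = 1 := by rw [norm_toE2, he]
  have hee : toC (toE2 e) = e := toC_toE2 e
  refine mem_image_thetaA_of_ivt (le_trans (by norm_num) half_le_outer_a₁) outer_radial he hw5
    (r₁ := latC k - 1 / 100) (r₂ := latC k + 1 / 60) (by linarith) (by linarith) (by linarith) ?_ ?_
  · rw [← hee, outerPot_ray he' (by linarith)]
    have := one_lt_planarPot_outerZ he' (s := latC k - 1 / 100) (by linarith) (by linarith) (k := k)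
    nlinarith [norm_nonneg w]
  · rw [← hee, outerPot_ray he' (by linarith)]
    have := planarPot_outerZ_lt_at_far_edge he' (k := k)
    nlinarith [norm_nonneg w]

/-- **The inverse straightening of `(e, w)`** (`|e| = 1`, `|w|² < 1/40`): a point `(q, w)` of the latitude
collar on the level `ĝ(q) + |w|² = 1` with `u₀(q) = e`. [folklore] -/
theorem collarOut_psi_spec (k : ℕ) {e w : ℂ} (he : ‖e‖ = 1) (hw : ‖w‖ ^ 2 < 1 / 40) :
    (invFunOn (ΘAout k) (CAout k) (e, w)).1 ∈ annulus 0 (latC k - 1 / 50) (latC k + 1 / 50) ∧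
      (invFunOn (ΘAout k) (CAout k) (e, w)).2 = w ∧
      outerPot k (invFunOn (ΘAout k) (CAout k) (e, w)).1 + ‖w‖ ^ 2 = 1 ∧
      unitDir 0 (invFunOn (ΘAout k) (CAout k) (e, w)).1 = e := by
  have himg := collarOut_mem_image k he hw
  set p := invFunOn (ΘAout k) (CAout k) (e, w) with hp
  have hpmem : p ∈ CAout k := invFunOn_thetaA_mem himg
  have hΘ : ΘAout k p = (e, w) := thetaA_invFunOn himg
  have hz : p.1 ∈ annulus 0 (latC k - 1 / 50) (latC k + 1 / 50) := hpmem.1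
  have h2 : p.2 = w := congrArg Prod.snd hΘ
  have hlev : outerPot k p.1 + ‖p.2‖ ^ 2 = 1 := by
    rw [level_iff_norm_thetaA_fst (c := (0 : ℂ)) (a₂ := latC k + 1 / 50) (le_trans (by norm_num) half_le_outer_a₁) outer_pos hz]
    show ‖(ΘAout k p).1‖ = 1
    rw [hΘ]; exact he
  have hu : unitDir 0 p.1 = e := by
    have h1 := thetaA_of_level (c := (0 : ℂ)) hlev
    rw [← ΘAout, hΘ] at h1
    exact (congrArg Prod.fst h1).symm
  rw [h2] at hlev
  exact ⟨hz, h2, hlev, hu⟩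

/-- The model point `(Λ⁻¹ q, w)` of the inverse straightening: on `M_k`, far, of latitude `|q|` and
co-latitude direction `toE2 e`. [folklore] -/
theorem collarOut_point_spec (k : ℕ) {e w : ℂ} (he : ‖e‖ = 1) (hw : ‖w‖ ^ 2 < 1 / 40) :
    ofZW (latCoordInv k (invFunOn (ΘAout k) (CAout k) (e, w)).1) w ∈ modelBoundary k ∧
      20 * ((k : ℝ) + 1) < ‖latCoordInv k (invFunOn (ΘAout k) (CAout k) (e, w)).1‖ ∧
      latCoord k (latCoordInv k (invFunOn (ΘAout k) (CAout k) (e, w)).1) = (invFunOn (ΘAout k) (CAout k) (e, w)).1 ∧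
      coLatDir k (latCoordInv k (invFunOn (ΘAout k) (CAout k) (e, w)).1) = toE2 e ∧
      latS k (latCoordInv k (invFunOn (ΘAout k) (CAout k) (e, w)).1) = ‖(invFunOn (ΘAout k) (CAout k) (e, w)).1‖ ∧
      0 < ‖(invFunOn (ΘAout k) (CAout k) (e, w)).1‖ ∧ ‖(invFunOn (ΘAout k) (CAout k) (e, w)).1‖ < 1 ∧
      coLat k (latCoordInv k (invFunOn (ΘAout k) (CAout k) (e, w)).1) ≠ 0 ∧
      planarPot k (latCoordInv k (invFunOn (ΘAout k) (CAout k) (e, w)).1) + ‖w‖ ^ 2 = 1 := by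
  obtain ⟨hann, -, hlev, hu⟩ := collarOut_psi_spec k he hw
  set q := (invFunOn (ΘAout k) (CAout k) (e, w)).1 with hqdef
  obtain ⟨hq0, hq0', hq1, hband⟩ := outer_annulus_bounds hann
  have hk : (0 : ℝ) ≤ k := Nat.cast_nonneg k
  have heu : ‖toE2 (unitDir 0 q)‖ = 1 := by rw [norm_toE2, norm_unitDir hq0]
  have hfar : 29 * ((k : ℝ) + 1) ≤ ‖latCoordInv k q‖ := by rw [latCoordInv]; exact le_norm_outerZ heu hband
  have hlev' : planarPot k (latCoordInv k q) + ‖w‖ ^ 2 = 1 := hlev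
  have hM : ofZW (latCoordInv k q) w ∈ modelBoundary k := by
    rw [← mem_Mset_iff, zC_ofZW, wC_ofZW]
    refine ⟨fun i => ?_, hlev'⟩
    rw [latCoordInv]
    have := norm_outerZ_sub_holeCentre_ge heu hband i
    linarith
  have hdir : coLatDir k (latCoordInv k q) = toE2 e := by
    rw [latCoordInv, coLatDir_outerZ heu hq0' hq1, hu]
  have hlat : latS k (latCoordInv k q) = ‖q‖ := by rw [latCoordInv, latS_outerZ heu hq0' hq1.le]
  have hco : coLat k (latCoordInv k q) ≠ 0 := by
    intro h0
    have h := latS_sq_add_norm_coLat_sq (k := k) (latCoordInv k q)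
    rw [h0, norm_zero, hlat] at h
    nlinarith
  exact ⟨hM, by linarith, latCoord_latCoordInv hq0 hq1, hdir, hlat, hq0', hq1, hco, hlev'⟩

/-- **The straightening inverts on the level**: `invFunOn Θᴬ (u₀(q), w) = (q, w)`. [folklore] -/
theorem collarOut_psi_theta (k : ℕ) {q w : ℂ} (hq : q ∈ annulus 0 (latC k - 1 / 50) (latC k + 1 / 50))
    (hw : ‖w‖ < 1 / 5) (hlev : outerPot k q + ‖w‖ ^ 2 = 1) :
    invFunOn (ΘAout k) (CAout k) (unitDir 0 q, w) = (q, w) := by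
  have h1 : ΘAout k (q, w) = (unitDir 0 q, w) := thetaA_of_level (p := (q, w)) hlev
  rw [← h1]
  exact invFunOn_thetaA (le_trans (by norm_num) half_le_outer_a₁) outer_pos outer_radial ⟨hq, hw⟩

/-- The chart lift of a point of `W₀`: a far point of `M_k` in the punctured `ε`-tube whose picture is the
point, with its latitude coordinate in the outer collar. [folklore] -/
theorem collarOut_lift_spec (hε : ε ≤ 1 / 40) {y : sphere (0 : EuclideanSpace ℝ (Fin 4)) 1}
    (hy : y ∈ (fun x : EuclideanSpace ℝ (Fin 4) => stereoNorthInv (draw k x)) ''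
      {x | x ∈ modelBoundary k ∧ wC x ≠ 0 ∧ ‖wC x‖ ^ 2 < ε ∧ 20 * ((k : ℝ) + 1) < ‖zC x‖}) :
    chartLift k (stereoNorthCoords (y : EuclideanSpace ℝ (Fin 4))) ∈ modelBoundary k ∧
      wC (chartLift k (stereoNorthCoords (y : EuclideanSpace ℝ (Fin 4)))) ≠ 0 ∧
      ‖wC (chartLift k (stereoNorthCoords (y : EuclideanSpace ℝ (Fin 4))))‖ ^ 2 < ε ∧
      20 * ((k : ℝ) + 1) < ‖zC (chartLift k (stereoNorthCoords (y : EuclideanSpace ℝ (Fin 4))))‖ ∧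
      stereoNorthInv (draw k (chartLift k (stereoNorthCoords (y : EuclideanSpace ℝ (Fin 4))))) = y ∧
      latCoord k (zC (chartLift k (stereoNorthCoords (y : EuclideanSpace ℝ (Fin 4))))) ∈ annulus 0 (latC k - 1 / 50) (latC k + 1 / 50) ∧
      coLat k (zC (chartLift k (stereoNorthCoords (y : EuclideanSpace ℝ (Fin 4))))) ≠ 0 ∧
      0 < latS k (zC (chartLift k (stereoNorthCoords (y : EuclideanSpace ℝ (Fin 4))))) := by
  obtain ⟨x, ⟨hx, hw, hwε, hfar⟩, rfl⟩ := hy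
  rw [pic_lift_P hx hw]
  have hM : (zC x, wC x) ∈ Mset k := (mem_Mset_iff x).2 hx
  have hzC : ‖zC x‖ < drawRadius k := norm_fst_lt_drawRadius_of_mem hM
  have hlev : planarPot k (zC x) + ‖wC x‖ ^ 2 = 1 := hM.2
  have hg : 19 / 20 ≤ planarPot k (zC x) := by linarith
  have h15 : 15 * ((k : ℝ) + 1) < ‖zC x‖ := by linarith
  refine ⟨hx, hw, hwε, hfar, rfl, ?_, coLat_ne_zero_of_lt_norm h15 hzC, latS_pos_of_norm_lt hzC⟩
  have h := latCoord_mem_annulus_of_far (k := k) (p := (zC x, wC x)) hM hfar.le hg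
  exact h

/-- `W₀` lies in the picture of `M_k ∖ {cores}`. [folklore] -/
theorem collarOut_subset :
    (fun x : EuclideanSpace ℝ (Fin 4) => stereoNorthInv (draw k x)) ''
      {x | x ∈ modelBoundary k ∧ wC x ≠ 0 ∧ ‖wC x‖ ^ 2 < ε ∧ 20 * ((k : ℝ) + 1) < ‖zC x‖} ⊆
    (fun x : EuclideanSpace ℝ (Fin 4) => stereoNorthInv (draw k x)) '' {x | x ∈ modelBoundary k ∧ wC x ≠ 0} :=
  image_mono fun _ hx => ⟨hx.1, hx.2.1⟩

end FriendsCarrierVk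

open FriendsCarrierVk in
/-- **Piece 3 of part I of V_k part A: the outer core collar of the picture is a thickened torus whose
first homology is generated by the core-parallel loop and the fibre circle.**  For `0 < ε ≤ 1/40`, on
`W₀ = P(M_k ∩ {0 < |w|² < ε} ∩ {|z| > 20(k+1)})` there are loops `A`, `B` with `A(t) = P(z_t, √ε/2)`,
co-latitude direction of `z_t` equal to `e^{2πit}`, and `B(t) = P(z₁, (√ε/2) e^{2πit})`, such that every class
of `H₁(W₀; ℤ)` is `a • h(A) + b • h(B)`. [cite: HatcherAT2002, §3.B] -/
theorem helper_friendsCarrier_Vk_partA_partI_collarOut : ∀ (k : ℕ) (ε : ℝ), 0 < ε → ε ≤ 1 / 40 → ∀ (W₀ : Set (sphere (0 : EuclideanSpace ℝ (Fin 4)) 1)), W₀ = (fun x : EuclideanSpace ℝ (Fin 4) => stereoNorthInv (draw k x)) '' {x | x ∈ modelBoundary k ∧ wC x ≠ 0 ∧ ‖wC x‖ ^ 2 < ε ∧ 20 * ((k : ℝ) + 1) < ‖zC x‖} → ∃ (p : ↥W₀) (A B : Path p p), (∀ t : unitInterval, ∃ z : ℂ, 20 * ((k : ℝ) + 1) < ‖z‖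 ∧ coLat k z ≠ 0 ∧ 0 < latS k z ∧ latS k z < 1 ∧ coLatDir k z = toE2 (Complex.exp ((2 * Real.pi * t : ℝ) * Complex.I)) ∧ ofZW z ((Real.sqrt ε / 2 : ℝ) : ℂ) ∈ modelBoundary k ∧ ((A t : ↥W₀) : sphere (0 : EuclideanSpace ℝ (Fin 4)) 1) = stereoNorthInv (draw k (ofZW z ((Real.sqrt ε / 2 : ℝ) : ℂ)))) ∧ (∃ z₁ : ℂ, 20 * ((k : ℝ) + 1) < ‖z₁‖ ∧ coLat k z₁ ≠ 0 ∧ 0 < latS k z₁ ∧ latCoord k z₁ ∈ annulus 0 (latC k - 1 / 50) (latC k + 1 / 50) ∧ planarPot k z₁ = 1 - ε / 4 ∧ ∀ t : unitInterval, ofZW z₁ (((Real.sqrt ε / 2 : ℝ) : ℂ) * Complex.exp ((2 * Real.pi * t : ℝ) * Complex.I)) ∈ modelBoundary k ∧ ((B t : ↥W₀) : sphere (0 : EuclideanSpace ℝ (Fin 4)) 1) = stereoNorthInv (draw k (ofZW z₁ (((Real.sqrt ε / 2 : ℝ) : ℂ) * Complex.exp ((2 * Real.pi * t : ℝ) * Complex.I)))))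 ∧ ∀ d : singularHomology ℤ ℤ ↥W₀ 1, ∃ a b : ℤ, d = a • loopClass ℤ ℤ (1 : ℤ) A + b • loopClass ℤ ℤ (1 : ℤ) B := by
  intro k ε hε hε' W₀ hW₀
  have hcp : ∀ t : ℝ, toC ((circlePoint (2 * Real.pi * t) : sphere (0 : EuclideanSpace ℝ (Fin 2)) 1) : EuclideanSpace ℝ (Fin 2)) =
      Complex.exp ((2 * Real.pi * t : ℝ) * Complex.I) := fun t => by rw [← circlePt_eq_circlePoint, toC_circlePt, Circle.coe_exp]
  have hcp0 : toC ((circlePoint 0 : sphere (0 : EuclideanSpace ℝ (Fin 2)) 1) : EuclideanSpace ℝ (Fin 2)) = 1 := by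
    have := hcp 0; rw [mul_zero] at this; rw [this]; simp
  have hsε : 0 < Real.sqrt ε := Real.sqrt_pos.2 hε
  have hsε2 : Real.sqrt ε ^ 2 = ε := Real.sq_sqrt hε.le
  -- the straightened coordinates of a point of `W₀`
  have hspec : ∀ y : ↥W₀, chartLift k (stereoNorthCoords ((y : sphere (0 : EuclideanSpace ℝ (Fin 4)) 1) : EuclideanSpace ℝ (Fin 4))) ∈ modelBoundary k ∧
      wC (chartLift k (stereoNorthCoords ((y : sphere (0 : EuclideanSpace ℝ (Fin 4)) 1) : EuclideanSpace ℝ (Fin 4)))) ≠ 0 ∧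
      ‖wC (chartLift k (stereoNorthCoords ((y : sphere (0 : EuclideanSpace ℝ (Fin 4)) 1) : EuclideanSpace ℝ (Fin 4))))‖ ^ 2 < ε ∧
      20 * ((k : ℝ) + 1) < ‖zC (chartLift k (stereoNorthCoords ((y : sphere (0 : EuclideanSpace ℝ (Fin 4)) 1) : EuclideanSpace ℝ (Fin 4))))‖ ∧
      stereoNorthInv (draw k (chartLift k (stereoNorthCoords ((y : sphere (0 : EuclideanSpace ℝ (Fin 4)) 1) : EuclideanSpace ℝ (Fin 4))))) = y ∧
      latCoord k (zC (chartLift k (stereoNorthCoords ((y : sphere (0 : EuclideanSpace ℝ (Fin 4)) 1) : EuclideanSpace ℝ (Fin 4))))) ∈ annulus 0 (latC k - 1 / 50) (latC k + 1 / 50) ∧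
      coLat k (zC (chartLift k (stereoNorthCoords ((y : sphere (0 : EuclideanSpace ℝ (Fin 4)) 1) : EuclideanSpace ℝ (Fin 4))))) ≠ 0 ∧
      0 < latS k (zC (chartLift k (stereoNorthCoords ((y : sphere (0 : EuclideanSpace ℝ (Fin 4)) 1) : EuclideanSpace ℝ (Fin 4))))) :=
    fun y => collarOut_lift_spec hε' (hW₀ ▸ y.2)
  have hlat0 : ∀ y : ↥W₀, latCoord k (zC (chartLift k (stereoNorthCoords ((y : sphere (0 : EuclideanSpace ℝ (Fin 4)) 1) : EuclideanSpace ℝ (Fin 4))))) ≠ 0 :=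
    fun y => (outer_annulus_bounds (hspec y).2.2.2.2.2.1).1
  -- the forward map
  set f : ↥W₀ → (sphere (0 : EuclideanSpace ℝ (Fin 2)) 1) × ↥puncturedDisc := fun y =>
    (radialProjection (circlePoint 0) (toE2 (latCoord k (zC (chartLift k (stereoNorthCoords ((y : sphere (0 : EuclideanSpace ℝ (Fin 4)) 1) : EuclideanSpace ℝ (Fin 4))))))),
      ⟨(Real.sqrt ε)⁻¹ • toE2 (wC (chartLift k (stereoNorthCoords ((y : sphere (0 : EuclideanSpace ℝ (Fin 4)) 1) : EuclideanSpace ℝ (Fin 4))))),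
        ⟨by
          rw [Ne, smul_eq_zero, not_or, toE2_eq_zero_iff]
          exact ⟨inv_ne_zero hsε.ne', (hspec y).2.1⟩, by
          rw [norm_smul, norm_inv, Real.norm_of_nonneg hsε.le, norm_toE2]
          rw [inv_mul_lt_iff₀ hsε, mul_one]
          have h3 := (hspec y).2.2.1
          by_contra hle; push Not at hle
          nlinarith [norm_nonneg (wC (chartLift k (stereoNorthCoords ((y : sphere (0 : EuclideanSpace ℝ (Fin 4)) 1) : EuclideanSpace ℝ (Fin 4)))))]⟩⟩) with hf
  -- the backward map
  have hew : ∀ q : (sphere (0 : EuclideanSpace ℝ (Fin 2)) 1) × ↥puncturedDisc,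
      ‖toC (q.1 : EuclideanSpace ℝ (Fin 2))‖ = 1 ∧ ((Real.sqrt ε : ℝ) : ℂ) * toC (q.2 : EuclideanSpace ℝ (Fin 2)) ≠ 0 ∧
        ‖((Real.sqrt ε : ℝ) : ℂ) * toC (q.2 : EuclideanSpace ℝ (Fin 2))‖ ^ 2 < ε := by
    intro q
    have hv0 : toC (q.2 : EuclideanSpace ℝ (Fin 2)) ≠ 0 := by
      rw [← norm_ne_zero_iff, norm_toC, norm_ne_zero_iff]; exact q.2.2.1
    refine ⟨norm_toC_sphere _, mul_ne_zero (by exact_mod_cast hsε.ne') hv0, ?_⟩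
    rw [norm_mul, Complex.norm_real, Real.norm_of_nonneg hsε.le, norm_toC, mul_pow, hsε2]
    have h1 : ‖(q.2 : EuclideanSpace ℝ (Fin 2))‖ < 1 := q.2.2.2
    have h0 : 0 ≤ ‖(q.2 : EuclideanSpace ℝ (Fin 2))‖ := norm_nonneg _
    have h2 : ‖(q.2 : EuclideanSpace ℝ (Fin 2))‖ ^ 2 < 1 := by nlinarith
    calc ε * ‖(q.2 : EuclideanSpace ℝ (Fin 2))‖ ^ 2 < ε * 1 := mul_lt_mul_of_pos_left h2 hε
      _ = ε := mul_one ε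
  have hew40 : ∀ q : (sphere (0 : EuclideanSpace ℝ (Fin 2)) 1) × ↥puncturedDisc,
      ‖((Real.sqrt ε : ℝ) : ℂ) * toC (q.2 : EuclideanSpace ℝ (Fin 2))‖ ^ 2 < 1 / 40 := fun q => lt_of_lt_of_le (hew q).2.2 hε'
  set g : (sphere (0 : EuclideanSpace ℝ (Fin 2)) 1) × ↥puncturedDisc → ↥W₀ := fun q =>
    ⟨stereoNorthInv (draw k (ofZW (latCoordInv k (invFunOn (ΘAout k) (CAout k) (toC (q.1 : EuclideanSpace ℝ (Fin 2)),
        ((Real.sqrt ε : ℝ) : ℂ) * toC (q.2 : EuclideanSpace ℝ (Fin 2)))).1) (((Real.sqrt ε : ℝ) : ℂ) * toC (q.2 : EuclideanSpace ℝ (Fin 2))))), by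
      rw [hW₀]
      obtain ⟨hM, hfar, -⟩ := collarOut_point_spec k (hew q).1 (hew40 q)
      exact ⟨_, ⟨hM, by rw [wC_ofZW]; exact (hew q).2.1, by rw [wC_ofZW]; exact (hew q).2.2, by rw [zC_ofZW]; exact hfar⟩, rfl⟩⟩ with hg
  have hgval : ∀ q, ((g q : ↥W₀) : sphere (0 : EuclideanSpace ℝ (Fin 4)) 1) = stereoNorthInv (draw k (ofZW (latCoordInv k (invFunOn (ΘAout k) (CAout k) (toC (q.1 : EuclideanSpace ℝ (Fin 2)),
      ((Real.sqrt ε : ℝ) : ℂ) * toC (q.2 : EuclideanSpace ℝ (Fin 2)))).1) (((Real.sqrt ε : ℝ) : ℂ) * toC (q.2 : EuclideanSpace ℝ (Fin 2))))) := fun q => rfl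
  have hfval1 : ∀ y, (f y).1 = radialProjection (circlePoint 0) (toE2 (latCoord k (zC (chartLift k (stereoNorthCoords ((y : sphere (0 : EuclideanSpace ℝ (Fin 4)) 1) : EuclideanSpace ℝ (Fin 4))))))) :=
    fun y => rfl
  have hfval2 : ∀ y, ((f y).2 : EuclideanSpace ℝ (Fin 2)) = (Real.sqrt ε)⁻¹ • toE2 (wC (chartLift k (stereoNorthCoords ((y : sphere (0 : EuclideanSpace ℝ (Fin 4)) 1) : EuclideanSpace ℝ (Fin 4))))) :=
    fun y => rfl
  -- `g ∘ f = id`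
  have hgf : ∀ y, g (f y) = y := by
    intro y
    obtain ⟨hM, hw0, hwε, hfar, hP, hann, hco, hs⟩ := hspec y
    set x := chartLift k (stereoNorthCoords ((y : sphere (0 : EuclideanSpace ℝ (Fin 4)) 1) : EuclideanSpace ℝ (Fin 4))) with hx
    have he : toC ((f y).1 : EuclideanSpace ℝ (Fin 2)) = unitDir 0 (latCoord k (zC x)) := by
      rw [hfval1, collarOut_toC_radialProjection (hlat0 y)]
    have hw : ((Real.sqrt ε : ℝ) : ℂ) * toC ((f y).2 : EuclideanSpace ℝ (Fin 2)) = wC x := by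
      rw [hfval2, toC_smul, toC_toE2, ← mul_assoc]
      push_cast
      rw [mul_inv_cancel₀ (by exact_mod_cast hsε.ne'), one_mul]
    have hw5 : ‖wC x‖ < 1 / 5 := by nlinarith [norm_nonneg (wC x)]
    have hlev : outerPot k (latCoord k (zC x)) + ‖wC x‖ ^ 2 = 1 := by
      have := hM.2
      rw [levelFun_eq_planarPot_add, Complex.normSq_eq_norm_sq] at this
      rw [outerPot_latCoord hco hs]; exact this
    apply Subtype.ext
    rw [hgval, he, hw, collarOut_psi_theta k hann hw5 hlev]
    simp only [latCoordInv_latCoord hco hs, ofZW_zC_wC]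
    exact hP
  -- `f ∘ g = id`
  have hfg : ∀ q, f (g q) = q := by
    intro q
    obtain ⟨he1, hw0, hwε⟩ := hew q
    obtain ⟨-, -, -, hu⟩ := collarOut_psi_spec k he1 (hew40 q)
    obtain ⟨hM, -, hlat, -⟩ := collarOut_point_spec k he1 (hew40 q)
    set p := invFunOn (ΘAout k) (CAout k) (toC (q.1 : EuclideanSpace ℝ (Fin 2)),
      ((Real.sqrt ε : ℝ) : ℂ) * toC (q.2 : EuclideanSpace ℝ (Fin 2))) with hp
    have hq0 : p.1 ≠ 0 := (outer_annulus_bounds (collarOut_psi_spec k he1 (hew40 q)).1).1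
    have hxw : wC (ofZW (latCoordInv k p.1) (((Real.sqrt ε : ℝ) : ℂ) * toC (q.2 : EuclideanSpace ℝ (Fin 2)))) ≠ 0 := by
      rw [wC_ofZW]; exact hw0
    have hlift : chartLift k (stereoNorthCoords (((g q : ↥W₀) : sphere (0 : EuclideanSpace ℝ (Fin 4)) 1) : EuclideanSpace ℝ (Fin 4))) =
        ofZW (latCoordInv k p.1) (((Real.sqrt ε : ℝ) : ℂ) * toC (q.2 : EuclideanSpace ℝ (Fin 2))) := by
      rw [hgval, pic_lift_P hM hxw]
    refine Prod.ext ?_ (Subtype.ext ?_)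
    · rw [hfval1, hlift, zC_ofZW, hlat]
      exact collarOut_radialProjection_eq hq0 hu
    · rw [hfval2, hlift, wC_ofZW, toE2_real_mul, toE2_toC, smul_smul, inv_mul_cancel₀ hsε.ne', one_smul]
  -- continuity of `f`
  have hWV : W₀ ⊆ (fun x : EuclideanSpace ℝ (Fin 4) => stereoNorthInv (draw k x)) '' {x | x ∈ modelBoundary k ∧ wC x ≠ 0} := by
    rw [hW₀]; exact collarOut_subset
  have hliftc : Continuous fun y : ↥W₀ => chartLift k (stereoNorthCoords ((y : sphere (0 : EuclideanSpace ℝ (Fin 4)) 1) : EuclideanSpace ℝ (Fin 4))) :=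
    pic_continuousOn_lift.comp_continuous continuous_subtype_val fun y => hWV y.2
  have hfc : Continuous f := by
    refine Continuous.prodMk ?_ (Continuous.subtype_mk ?_ _)
    · refine continuous_iff_continuousAt.2 fun y => ?_
      have hco := (hspec y).2.2.2.2.2.2.1
      have h0 : toE2 (latCoord k (zC (chartLift k (stereoNorthCoords ((y : sphere (0 : EuclideanSpace ℝ (Fin 4)) 1) : EuclideanSpace ℝ (Fin 4)))))) ≠ 0 := by
        rw [Ne, toE2_eq_zero_iff]; exact hlat0 y
      have h1 : ContinuousAt (fun y : ↥W₀ => toE2 (latCoord k (zC (chartLift k (stereoNorthCoords ((y : sphere (0 : EuclideanSpace ℝ (Fin 4)) 1) : EuclideanSpace ℝ (Fin 4))))))) y :=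
        contDiff_toE2.continuous.continuousAt.comp (ContinuousAt.comp (g := latCoord k)
          (f := fun y : ↥W₀ => zC (chartLift k (stereoNorthCoords ((y : sphere (0 : EuclideanSpace ℝ (Fin 4)) 1) : EuclideanSpace ℝ (Fin 4)))))
          (x := y) (contDiffAt_latCoord hco).continuousAt (continuous_zC.comp hliftc).continuousAt)
      exact ContinuousAt.comp (g := radialProjection (circlePoint 0))
        (f := fun y : ↥W₀ => toE2 (latCoord k (zC (chartLift k (stereoNorthCoords ((y : sphere (0 : EuclideanSpace ℝ (Fin 4)) 1) : EuclideanSpace ℝ (Fin 4)))))))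
        (x := y) ((continuousOn_radialProjection _).continuousAt (isOpen_ne.mem_nhds h0)) h1
    · exact (continuous_const (y := (Real.sqrt ε)⁻¹)).smul (contDiff_toE2.continuous.comp (continuous_wC.comp hliftc))
  -- continuity of `g`
  have hgc : Continuous g := by
    refine Continuous.subtype_mk ?_ _
    have hqc : Continuous fun q : (sphere (0 : EuclideanSpace ℝ (Fin 2)) 1) × ↥puncturedDisc =>
        (toC (q.1 : EuclideanSpace ℝ (Fin 2)), ((Real.sqrt ε : ℝ) : ℂ) * toC (q.2 : EuclideanSpace ℝ (Fin 2))) :=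
      (contDiff_toC.continuous.comp (continuous_subtype_val.comp continuous_fst)).prodMk
        (continuous_const.mul (contDiff_toC.continuous.comp (continuous_subtype_val.comp continuous_snd)))
    have hΨc : Continuous fun q : (sphere (0 : EuclideanSpace ℝ (Fin 2)) 1) × ↥puncturedDisc =>
        invFunOn (ΘAout k) (CAout k) (toC (q.1 : EuclideanSpace ℝ (Fin 2)), ((Real.sqrt ε : ℝ) : ℂ) * toC (q.2 : EuclideanSpace ℝ (Fin 2))) :=
      ΘAout_straighten.2.continuousOn.comp_continuous hqc fun q => collarOut_mem_image k (hew q).1 (hew40 q)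
    have hzc : Continuous fun q : (sphere (0 : EuclideanSpace ℝ (Fin 2)) 1) × ↥puncturedDisc =>
        latCoordInv k (invFunOn (ΘAout k) (CAout k) (toC (q.1 : EuclideanSpace ℝ (Fin 2)), ((Real.sqrt ε : ℝ) : ℂ) * toC (q.2 : EuclideanSpace ℝ (Fin 2)))).1 := by
      refine continuous_iff_continuousAt.2 fun q => ?_
      obtain ⟨hq0, -, hq1, -⟩ := outer_annulus_bounds (collarOut_psi_spec k (hew q).1 (hew40 q)).1
      exact ContinuousAt.comp (g := latCoordInv k)
        (f := fun q : (sphere (0 : EuclideanSpace ℝ (Fin 2)) 1) × ↥puncturedDisc =>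
          (invFunOn (ΘAout k) (CAout k) (toC (q.1 : EuclideanSpace ℝ (Fin 2)), ((Real.sqrt ε : ℝ) : ℂ) * toC (q.2 : EuclideanSpace ℝ (Fin 2)))).1)
        (x := q) (contDiffAt_latCoordInv hq0 hq1).continuousAt (continuous_fst.comp hΨc).continuousAt
    have hxc : Continuous fun q : (sphere (0 : EuclideanSpace ℝ (Fin 2)) 1) × ↥puncturedDisc =>
        ofZW (latCoordInv k (invFunOn (ΘAout k) (CAout k) (toC (q.1 : EuclideanSpace ℝ (Fin 2)),
          ((Real.sqrt ε : ℝ) : ℂ) * toC (q.2 : EuclideanSpace ℝ (Fin 2)))).1) (((Real.sqrt ε : ℝ) : ℂ) * toC (q.2 : EuclideanSpace ℝ (Fin 2))) :=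
      continuous_ofZW.comp (hzc.prodMk (continuous_snd.comp hqc))
    exact pic_continuousOn_P.comp_continuous hxc fun q => by
      show wC _ ≠ 0
      rw [wC_ofZW]; exact (hew q).2.1
  -- the homeomorphism and the generators
  let h : ↥W₀ ≃ₜ (sphere (0 : EuclideanSpace ℝ (Fin 2)) 1) × ↥puncturedDisc :=
    { toFun := f, invFun := g, left_inv := hgf, right_inv := hfg, continuous_toFun := hfc, continuous_invFun := hgc }
  refine ⟨g surgeryModel.base, surgeryModel.lonLoop.map hgc, surgeryModel.merLoop.map hgc, ?_, ?_, ?_⟩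
  · intro t
    set q : (sphere (0 : EuclideanSpace ℝ (Fin 2)) 1) × ↥puncturedDisc := surgeryModel.lonLoop t with hq
    have hq1' : toC (q.1 : EuclideanSpace ℝ (Fin 2)) = Complex.exp ((2 * Real.pi * t : ℝ) * Complex.I) := by
      rw [hq]; exact hcp t
    have hq2 : ((Real.sqrt ε : ℝ) : ℂ) * toC (q.2 : EuclideanSpace ℝ (Fin 2)) = ((Real.sqrt ε / 2 : ℝ) : ℂ) := by
      rw [hq]
      show ((Real.sqrt ε : ℝ) : ℂ) * toC (((puncturedDisc.half (circlePoint 0) : ↥puncturedDisc) : EuclideanSpace ℝ (Fin 2))) = _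
      rw [puncturedDisc.coe_half_apply, toC_smul, hcp0]
      push_cast; ring
    obtain ⟨he1, hw⟩ := hew q
    have hw40 := hew40 q
    rw [hq1'] at he1
    rw [hq2] at hw hw40
    obtain ⟨hM, hfar, -, hdir, hlat, hq0', hq1, hco, -⟩ := collarOut_point_spec k he1 hw40
    refine ⟨_, hfar, hco, by rw [hlat]; exact hq0', by rw [hlat]; exact hq1, by rw [hdir], hM, ?_⟩
    rw [Path.map_coe, Function.comp_apply, ← hq, hgval, hq1', hq2]
  · have he1 : ‖(1 : ℂ)‖ = 1 := norm_one
    have hw1 : ((Real.sqrt ε / 2 : ℝ) : ℂ) ≠ 0 ∧ ‖((Real.sqrt ε / 2 : ℝ) : ℂ)‖ ^ 2 < ε := by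
      refine ⟨by exact_mod_cast (by positivity : Real.sqrt ε / 2 ≠ 0), ?_⟩
      rw [Complex.norm_real, Real.norm_of_nonneg (by positivity), div_pow, hsε2]; linarith
    have hw140 : ‖((Real.sqrt ε / 2 : ℝ) : ℂ)‖ ^ 2 < 1 / 40 := lt_of_lt_of_le hw1.2 hε'
    have hn1 : ‖((Real.sqrt ε / 2 : ℝ) : ℂ)‖ ^ 2 = ε / 4 := by
      rw [Complex.norm_real, Real.norm_of_nonneg (by positivity), div_pow, hsε2]; ring
    obtain ⟨hM₁, hfar, hlatc, -, hlat, hq0', -, hco, hlev⟩ := collarOut_point_spec k he1 hw140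
    refine ⟨_, hfar, hco, by rw [hlat]; exact hq0', by rw [hlatc]; exact (collarOut_psi_spec k he1 hw140).1,
      by rw [hn1] at hlev; linarith, fun t => ?_⟩
    set q : (sphere (0 : EuclideanSpace ℝ (Fin 2)) 1) × ↥puncturedDisc := surgeryModel.merLoop t with hq
    have hq1 : toC (q.1 : EuclideanSpace ℝ (Fin 2)) = 1 := by rw [hq]; exact hcp0
    have hq2 : ((Real.sqrt ε : ℝ) : ℂ) * toC (q.2 : EuclideanSpace ℝ (Fin 2)) =
        ((Real.sqrt ε / 2 : ℝ) : ℂ) * Complex.exp ((2 * Real.pi * t : ℝ) * Complex.I) := by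
      rw [hq]
      show ((Real.sqrt ε : ℝ) : ℂ) * toC (((puncturedDisc.half (circlePoint (2 * Real.pi * t)) : ↥puncturedDisc) : EuclideanSpace ℝ (Fin 2))) = _
      rw [puncturedDisc.coe_half_apply, toC_smul, hcp]
      push_cast; ring
    have hn : ‖((Real.sqrt ε / 2 : ℝ) : ℂ) * Complex.exp ((2 * Real.pi * t : ℝ) * Complex.I)‖ = ‖((Real.sqrt ε / 2 : ℝ) : ℂ)‖ := by
      rw [norm_mul, Complex.norm_exp_ofReal_mul_I, mul_one]
    have hwt40 := hew40 q
    rw [hq2] at hwt40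
    -- the `q`-component only depends on `|w|`
    have hz : (invFunOn (ΘAout k) (CAout k) (1, ((Real.sqrt ε / 2 : ℝ) : ℂ) * Complex.exp ((2 * Real.pi * t : ℝ) * Complex.I))).1 =
        (invFunOn (ΘAout k) (CAout k) (1, ((Real.sqrt ε / 2 : ℝ) : ℂ))).1 := by
      obtain ⟨hza, -, hleva, hua⟩ := collarOut_psi_spec k he1 hwt40
      obtain ⟨hzb, -, hlevb, hub⟩ := collarOut_psi_spec k he1 hw140
      rw [hn] at hleva
      have hw5 : ‖((Real.sqrt ε / 2 : ℝ) : ℂ)‖ < 1 / 5 := by nlinarith [norm_nonneg (((Real.sqrt ε / 2 : ℝ) : ℂ))]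
      have ea := collarOut_psi_theta k hza hw5 hleva
      have eb := collarOut_psi_theta k hzb hw5 hlevb
      rw [hua] at ea; rw [hub] at eb
      exact (Prod.ext_iff.1 (ea.symm.trans eb)).1
    obtain ⟨hMt, -⟩ := collarOut_point_spec k he1 hwt40
    rw [hz] at hMt
    refine ⟨hMt, ?_⟩
    rw [Path.map_coe, Function.comp_apply, ← hq, hgval, hq1, hq2, hz]
  · intro d
    obtain ⟨i, i', hd⟩ := surgeryModel.exists_eq_zsmul_add_zsmul (singularHomology.map ℤ ℤ (h : C(↥W₀, (sphere (0 : EuclideanSpace ℝ (Fin 2)) 1) × ↥puncturedDisc)) 1 d)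
    refine ⟨i, i', ?_⟩
    have hback : singularHomology.map ℤ ℤ (h.symm : C((sphere (0 : EuclideanSpace ℝ (Fin 2)) 1) × ↥puncturedDisc, ↥W₀)) 1
        (singularHomology.map ℤ ℤ (h : C(↥W₀, (sphere (0 : EuclideanSpace ℝ (Fin 2)) 1) × ↥puncturedDisc)) 1 d) = d := by
      rw [← ModuleCat.comp_apply, ← singularHomology.map_comp]
      rw [show (h.symm : C((sphere (0 : EuclideanSpace ℝ (Fin 2)) 1) × ↥puncturedDisc, ↥W₀)).comp
          (h : C(↥W₀, (sphere (0 : EuclideanSpace ℝ (Fin 2)) 1) × ↥puncturedDisc)) = ContinuousMap.id _ from by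
          ext y : 1; exact h.symm_apply_apply y,
        singularHomology.map_id, ModuleCat.id_apply]
    rw [← hback, hd, map_add, map_zsmul, map_zsmul, map_loopClass, map_loopClass]
    rfl

end Summit.SmoothPoincare4.SmoothPoincare4.Theorems.DcrGap.MkFriends
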